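/-
Copyright (c) 2026 the pub-hodgecm-mathlib formalisation cell (harness21).  Prover seat hodgecm-mathlib-F0P2-p02 (g9), ROAD W brick (W5), 2026-09-01.
-/
import Literature.Combinatorics.SimpleGraph.TreeRetractionOntoSubtree   -- ★ p843004: `TreeRetraction.exists_retraction` (height ∕ parent toward a subtree, equivariance)
import HarnessLib

/-!
# The axis of a translation of a tree: the orbit `τ^ℤ v₀` of a vertex moved to a neighbour is a geodesic line (Serre, *Trees* I.6.4 Prop. 24–25)

Topic `Combinatorics/SimpleGraph`; namespace `Literature.Combinatorics.SimpleGraph.TreeAction`.  THEOREMS ONLY (no definition, no instance, no notation, no named fact,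
no `sorry`); Mathlib + two ★ orbit-counting ∕ retraction files.  Cell `pub/hodgecm-mathlib`, F0∕P3a, crux H413 = stmt-HodgeConjecture-24833, line «N6nsGerm», residue
`stub_N6nsR2ram : RankOneEulerPoincareNonsplitRamified`, ROAD W («R2EP-wild»: the letter (R2) at a RAMIFIED place through the tree `X` of `SL₂(F_v)`, on which `U(Φ₂)(E_w)`
acts through `PGL₂(F_v)` WITH inversions — MEMO `F0/P3a/F0P3a-p04/g13/MEMO-R2wild.F0P3a-p04g13.md`), brick (W5) «per-period non-elliptic relation», TREE SIDE; seat F0P2-p02 (g9)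
(B-p14 (g32) 10:23:49Z hands: (W1c)(W2) B-p08 (g28), (W3)(W4) B-p14, (W5) F0P2-p02; census `F0/P2/p02/g9/CENSUS-W5-NonEllipticPerPeriod.F0P2p02g9.md`).
HONEST LABEL: HC_CM is proved only modulo the printed citations until rung 0 closes; this file is pure orbit counting on a tree and asserts nothing printed.

THE MATHEMATICS.  A group `Φ` acts on the vertex set `V` of a tree `G` by graph automorphisms and is generated by one element `τ` which moves a vertex `v₀` to a NEIGHBOUR
and acts freely on it (`τ^n v₀ = v₀ ⇒ n = 0`).  Then the orbit `Y = τ^ℤ v₀` is a bi-infinite geodesic — `τ^m v₀ ~ τ^n v₀ ↔ |m − n| = 1` (§1, uniqueness of paths in a tree) —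
the AXIS of the translation `τ`.  Let `γ` be a further automorphism of `G` commuting with `Φ`.
* If `γ v₀ = v₀` (§3), `γ` fixes `Y` pointwise, its fixed vertices `F` form a subtree containing `Y` (nearest-point retraction `(h, p)` onto `Y`, ★ `exists_retraction`,
  is `γ`- and `Φ`-equivariant), and «vertex `↦` the edge below it (`{v, p v}` off the axis, `{v, τv}` on it)» is a `Φ`-equivariant BIJECTION from the fixed vertices onto
  the set-wise fixed edges (no fixed edge is inverted: `γ` preserves heights), while the fixed darts split `Φ`-equivariantly as «down-or-forward» ⊔ «up-or-backward», each
  half in bijection with the fixed edges.  Counting `Φ`-orbits («per period»): **`#(F∕Φ) + #(fixed edges∕Φ) = #(fixed darts∕Φ)`** (both sides `= 2·#(fixed edges∕Φ)`).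
* If `γ v₀ = τ^k v₀` with `k ≠ 0` (§4), `γ` translates the axis, and the iterated-parent projection onto `Y` (again equivariant) shows that `γ` fixes NO vertex, NO edge
  (set-wise) and NO dart: the identity reads `0 + 0 = 0`.
Orbit counts are typed choice-free as `Nat.card (Quotient ((MulAction.orbitRel Φ X).comap (Subtype.val : S → X)))` (the currency of ★ `OrbitQuotientTubeCount`, ★
`OrbitalIntegralFixedPointsPerPeriodQuotient`); edges are two-element SETS of vertices under the pointwise action (so «set-wise fixed» is `γ '' s = s`), darts are ordered
adjacent pairs.  Only the finiteness of the dart quotient is assumed (it implies the other two).  The COSET side — `Φ = τ^ℤ ≤ Z_Γ(γ)` acting on `Γ ⧸ K_v`, `Γ ⧸ K_e`, `Γ ⧸ I`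
for a group `Γ` acting on `G` with one vertex orbit and one dart orbit — is the sequel ★ `TreeActionNonEllipticPerPeriod` (B-p14 (g32)'s (W3)(W4) binders verbatim).

THIS FILE (part 1 of 2): §1 `exists_path_pow_smul`, **`adj_zpow_smul_iff`** (the axis is a geodesic line: `τ^m v₀ ~ τ^n v₀ ↔ |m − n| = 1`); §2 `smul_comm_of_generator`,
`smul_mem_axis_iff`, **`connected_induce_axis`**.  Part 2 ★ `TreeActionAxisPerPeriod`: the per-period identity (§3 `γ v₀ = v₀`, §4 `γ v₀ = τ^k v₀`, `k ≠ 0`).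

## References
* [Kottwitz1988] R. E. Kottwitz, *Tamagawa numbers*, Ann. of Math. 127 (1988), 629–646, §2 Theorem 2 (non-elliptic case: `O_γ(f_EP) = 0`).
* [Serre1980Trees] J.-P. Serre, *Trees*, Springer (1980): I.2.2 Prop. 8 (unique geodesics), I.6.4 Prop. 24–25 (hyperbolic automorphisms, axis, projection), II.1.1–1.3
  (the tree of `SL₂`; `GL₂` acts through `PGL₂` with inversions).
* [Laumon1995] G. Laumon, *Cohomology of Drinfeld Modular Varieties* I (1996), Lemma (5.3.2) (orbital integrals as counts of fixed facets modulo the centraliser).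
-/

set_option autoImplicit false

open SimpleGraph MulAction

namespace Literature.Combinatorics.SimpleGraph.TreeAction

open Literature.Combinatorics.SimpleGraph

variable {V : Type*} {G : SimpleGraph V} {Φ : Type*} [Group Φ] [MulAction Φ V]

/-! ## §1 The axis of a translation is a geodesic line -/

section Axis

/-- **The walk `v₀, τv₀, τ²v₀, …, τ^j v₀` is a PATH of length `j`** when `τ` acts by a graph automorphism, `v₀ ~ τ v₀`, and `τ` acts freely on `v₀`
(its vertices are pairwise distinct by freeness). [cite: Serre1980Trees, I.6.4 Prop. 24] -/
theorem exists_path_pow_smul (hadj : ∀ (φ : Φ) (a b : V), G.Adj (φ • a) (φ • b) ↔ G.Adj a b) (τ : Φ) (v₀ : V)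
    (hstep : G.Adj v₀ (τ • v₀)) (hfree : ∀ n : ℤ, τ ^ n • v₀ = v₀ → n = 0) (j : ℕ) :
    ∃ p : G.Walk v₀ (τ ^ j • v₀), p.IsPath ∧ p.length = j ∧ ∀ u ∈ p.support, ∃ i : ℕ, i ≤ j ∧ u = τ ^ i • v₀ := by
  induction j with
  | zero => exact ⟨(Walk.nil : G.Walk v₀ v₀).copy rfl (by rw [pow_zero, one_smul]), by simp, by simp, fun u hu => ⟨0, le_rfl, by simpa using hu⟩⟩
  | succ j ih =>
    obtain ⟨p, hp, hlen, hsupp⟩ := ih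
    -- push the path forward by `τ` and prepend the edge `v₀ — τ v₀`
    let f : G →g G := ⟨fun v => τ • v, fun {a b} h => (hadj τ a b).2 h⟩
    have hfinj : Function.Injective f := MulAction.injective τ
    let q : G.Walk (τ • v₀) (τ ^ (j + 1) • v₀) := (p.map f).copy rfl (by rw [pow_succ', mul_smul]; rfl)
    have hq : q.IsPath := by
      simp only [q, Walk.isPath_copy]
      exact (Walk.isPath_map_iff_of_injective hfinj).2 hp
    have hqsupp : ∀ u ∈ q.support, ∃ i : ℕ, i ≤ j ∧ u = τ • τ ^ i • v₀ := fun u hu => by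
      simp only [q, Walk.support_copy, Walk.support_map, List.mem_map] at hu
      obtain ⟨w, hw, rfl⟩ := hu
      obtain ⟨i, hi, rfl⟩ := hsupp w hw
      exact ⟨i, hi, rfl⟩
    have hnot : v₀ ∉ q.support := fun h0 => by
      obtain ⟨i, -, hi⟩ := hqsupp v₀ h0
      have h1 : τ ^ ((i + 1 : ℕ) : ℤ) • v₀ = v₀ := by rw [zpow_natCast, pow_succ', mul_smul]; exact hi.symm
      have := hfree _ h1
      omega
    refine ⟨Walk.cons hstep q, (Walk.cons_isPath_iff hstep q).2 ⟨hq, hnot⟩, by simp [q, hlen], fun u hu => ?_⟩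
    rw [Walk.support_cons, List.mem_cons] at hu
    rcases hu with rfl | hu
    · exact ⟨0, Nat.zero_le _, by rw [pow_zero, one_smul]⟩
    · obtain ⟨i, hi, rfl⟩ := hqsupp u hu
      exact ⟨i + 1, by omega, by rw [pow_succ', mul_smul]⟩

/-- **THE AXIS IS A GEODESIC LINE**: in an acyclic graph, if `Φ` acts by automorphisms, `v₀ ~ τ v₀` and `τ^n v₀ = v₀ ⇒ n = 0`, then
`τ^m v₀ ~ τ^n v₀ ↔ n = m + 1 ∨ m = n + 1` (a second adjacency would give two distinct paths between two orbit points). [cite: Serre1980Trees, I.2.2 Prop. 8; I.6.4 Prop. 24] -/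
theorem adj_zpow_smul_iff (hacyc : G.IsAcyclic) (hadj : ∀ (φ : Φ) (a b : V), G.Adj (φ • a) (φ • b) ↔ G.Adj a b) (τ : Φ) (v₀ : V)
    (hstep : G.Adj v₀ (τ • v₀)) (hfree : ∀ n : ℤ, τ ^ n • v₀ = v₀ → n = 0) (m n : ℤ) :
    G.Adj (τ ^ m • v₀) (τ ^ n • v₀) ↔ n = m + 1 ∨ m = n + 1 := by
  -- the case `m = 0`, `n = j ≥ 0`
  have hnat : ∀ j : ℕ, G.Adj v₀ (τ ^ j • v₀) → j = 1 := fun j hj => by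
    obtain ⟨p, hp, hlen, -⟩ := exists_path_pow_smul hadj τ v₀ hstep hfree j
    have heq := hacyc.path_unique ⟨p, hp⟩ ⟨hj.toWalk, Walk.IsPath.of_adj hj⟩
    have := congrArg (fun P : G.Path v₀ (τ ^ j • v₀) => (P : G.Walk v₀ (τ ^ j • v₀)).length) heq
    simp only [hlen, Walk.length_cons, Walk.length_nil] at this
    exact this
  -- the case `m = 0`
  have hzero : ∀ k : ℤ, G.Adj v₀ (τ ^ k • v₀) → k = 1 ∨ k = -1 := fun k hk => by
    obtain ⟨j, rfl | rfl⟩ := k.eq_nat_or_neg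
    · rw [zpow_natCast] at hk
      exact Or.inl (by rw [hnat j hk]; rfl)
    · right
      have hk' : G.Adj (τ ^ (j : ℤ) • v₀) (τ ^ (j : ℤ) • τ ^ (-(j : ℤ)) • v₀) := (hadj _ _ _).2 hk
      rw [smul_smul, ← zpow_add, add_neg_cancel, zpow_zero, one_smul, zpow_natCast] at hk'
      rw [hnat j hk'.symm]; rfl
  constructor
  · intro h
    have h' : G.Adj (τ ^ (-m) • τ ^ m • v₀) (τ ^ (-m) • τ ^ n • v₀) := (hadj _ _ _).2 h
    rw [smul_smul, smul_smul, ← zpow_add, ← zpow_add, neg_add_cancel, zpow_zero, one_smul] at h'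
    rcases hzero _ h' with h1 | h1
    · left; omega
    · right; omega
  · rintro (rfl | rfl)
    · rw [zpow_add_one, mul_smul]
      exact (hadj _ _ _).2 hstep
    · rw [zpow_add_one, mul_smul]
      exact ((hadj _ _ _).2 hstep).symm

/-- `τ` commutes with every element of `Φ = τ^ℤ` on `V`. [cite: Serre1980Trees, I.6.4] -/
theorem smul_comm_of_generator (τ : Φ) (hgen : ∀ φ : Φ, ∃ n : ℤ, τ ^ n = φ) (φ : Φ) (k : ℤ) (v : V) : φ • τ ^ k • v = τ ^ k • φ • v := by
  obtain ⟨n, rfl⟩ := hgen φ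
  rw [smul_smul, smul_smul, ← zpow_add, ← zpow_add, add_comm]

/-- **The axis `Y = τ^ℤ v₀` is `Φ`-invariant** (`Φ = τ^ℤ`). [cite: Serre1980Trees, I.6.4 Prop. 24] -/
theorem smul_mem_axis_iff (τ : Φ) (hgen : ∀ φ : Φ, ∃ n : ℤ, τ ^ n = φ) (v₀ : V) (φ : Φ) (v : V) :
    φ • v ∈ {v : V | ∃ n : ℤ, τ ^ n • v₀ = v} ↔ v ∈ {v : V | ∃ n : ℤ, τ ^ n • v₀ = v} := by
  obtain ⟨n, rfl⟩ := hgen φ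
  simp only [Set.mem_setOf_eq]
  constructor
  · rintro ⟨m, hm⟩
    refine ⟨m - n, ?_⟩
    have := congrArg (fun x => τ ^ (-n) • x) hm
    simp only [smul_smul, ← zpow_add, neg_add_cancel, zpow_zero, one_smul] at this
    rw [← this, sub_eq_add_neg, add_comm]
  · rintro ⟨m, hm⟩
    exact ⟨n + m, by rw [zpow_add, mul_smul, hm]⟩

/-- **The axis is connected** (consecutive points are adjacent). [cite: Serre1980Trees, I.6.4 Prop. 24] -/
theorem connected_induce_axis (hadj : ∀ (φ : Φ) (a b : V), G.Adj (φ • a) (φ • b) ↔ G.Adj a b) (τ : Φ) (v₀ : V) (hstep : G.Adj v₀ (τ • v₀)) :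
    (G.induce {v : V | ∃ n : ℤ, τ ^ n • v₀ = v}).Connected := by
  have h0 : v₀ ∈ {v : V | ∃ n : ℤ, τ ^ n • v₀ = v} := ⟨0, by rw [zpow_zero, one_smul]⟩
  haveI : Nonempty ↥{v : V | ∃ n : ℤ, τ ^ n • v₀ = v} := ⟨⟨v₀, h0⟩⟩
  -- every axis point is reachable from `v₀` inside the axis
  have hstepk : ∀ k : ℤ, G.Adj (τ ^ k • v₀) (τ ^ (k + 1) • v₀) := fun k => by
    rw [zpow_add_one, mul_smul]; exact (hadj _ _ _).2 hstep
  have hreach : ∀ k : ℤ, (G.induce {v : V | ∃ n : ℤ, τ ^ n • v₀ = v}).Reachable ⟨v₀, h0⟩ ⟨τ ^ k • v₀, k, rfl⟩ := fun k => by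
    induction k using Int.induction_on with
    | zero =>
      have e : τ ^ (0 : ℤ) • v₀ = v₀ := by rw [zpow_zero, one_smul]
      exact ⟨(Walk.nil : (G.induce {v : V | ∃ n : ℤ, τ ^ n • v₀ = v}).Walk ⟨v₀, h0⟩ ⟨v₀, h0⟩).copy rfl (Subtype.ext e.symm)⟩
    | succ k ih =>
      refine ih.trans (Adj.reachable ?_)
      rw [induce_adj]
      exact_mod_cast hstepk k
    | pred k ih =>
      refine ih.trans (Adj.reachable ?_)
      rw [induce_adj]
      have := (hstepk (-(k : ℤ) - 1)).symm
      rw [sub_add_cancel] at this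
      exact this
  refine Connected.mk fun a b => ?_
  obtain ⟨m, hm⟩ := a.2
  obtain ⟨n, hn⟩ := b.2
  have ha : a = ⟨τ ^ m • v₀, m, rfl⟩ := Subtype.ext hm.symm
  have hb : b = ⟨τ ^ n • v₀, n, rfl⟩ := Subtype.ext hn.symm
  rw [ha, hb]
  exact (hreach m).symm.trans (hreach n)

end Axis


end Literature.Combinatorics.SimpleGraph.TreeAction
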